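import Literature.Geometry.Lorentzian.MetricDensityRatio
import Literature.Geometry.Lorentzian.WeakSolutionChart
import Literature.Analysis.Distribution.HeatHypoelliptic
import HarnessLib

/-!
# Interior regularity of very weak solutions of the linear heat equation on a closed manifold

Second step of the solvability of the linear heat-type Cauchy problem
`∂ₛw = Δ_{h(s)}w − Qw` on a closed manifold (the hypothesis `hLP` of
`perelman_noLocalCollapsing_of_linearHeat`, `PerelmanNoncollapsingLinearHeat.lean`; discharge of
the named fact `Literature.Geometry.Riemannian.perelman_noLocalCollapsing`, Perelman 2002,
Thm. 4.1): **a very weak solution is smooth in the interior of the time interval.** The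
analysis is Hörmander's hypoellipticity theorem for the heat operator (Hörmander 1967, Thm 1.1
and p. 147, PROVED in this tree — `hormander1967_thm11_proof` — and specialised to parabolic
operators in coordinates in `HeatHypoelliptic.lean`); this file does the geometry:

* the very weak formulation on `M × T` with respect to the product reference measure
  `dV_{g₀} ⊗ ds`: `∫ u (−∂ₛ(ρζ) − ρΔ_{h(s)}ζ + ρQζ) = ∫ ρGζ` for smooth `ζ` compactly supported in
  `M × T`, `ρ = dV_{h(s)}/dV_{g₀}` the density ratio (`MetricDensityRatio.lean`);
* `integral_heatTranspose_chart_of_veryWeak` — **the equation read in a product chart**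
  `φ × id`: `∫ ū · heatTranspose A J q ψ = ∫ F ψ` with `J = √det h(s)ᵢⱼ`, `A = J h(s)⁻¹`,
  `q = J Q`, `F = J G` (zero extension of chart test functions,
  `contMDiff_indicator_comp_extChartAt_prod`; Fubini; the chart formula for `dV_{g₀}`,
  `integral_eq_integral_chart`; the divergence form of the coordinate Laplacian,
  `dalembertian_eq_sum_localFrame` + `coordLaplacian_mul_sqrt_det_eq_sum_fderiv`; the density
  identity `ρ √det(g₀)ᵢⱼ = √det h(s)ᵢⱼ`, `densityRatio_mul_sqrt_det_chartGramMatrix`);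
* `locallyIntegrableOn_comp_chart_prod`, `ae_prod_chart_of_ae_volume` — local integrability
  and null sets pass between `(M × ℝ, dV_{g₀} ⊗ ds)` and the space-time chart;
* `exists_contMDiffOn_ae_eq_of_forall_exists_nhds` — patching local smooth representatives on
  an open set;
* **`exists_contMDiffOn_ae_eq_of_linearHeat_veryWeak`** — a measurable, locally integrable very
  weak solution of `∂ₛu = Δ_{h(s)}u − Qu + G` on `M × T` agrees a.e. with a function `C^∞` on
  `M × T`.

Everything is proved; no definitions, no named facts.

## References

* L. Hörmander, *Hypoelliptic second order differential equations*, Acta Math. 119 (1967)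
  147–171, Thm 1.1, p. 147 (the heat equation is hypoelliptic). [Hormander1967]
* I. Chavel, *Riemannian Geometry: A Modern Introduction*, 2nd ed., CUP 2006, §III.3 (III.3.6)
  and §III.7. [Chavel2006]
* P. Topping, *Lectures on the Ricci flow* (2006), Rem. 8.2.5 with §6.4 (the linear parabolic
  equation to be solved). [Topping2006]
-/

noncomputable section

open Bundle Set Function Filter Manifold MeasureTheory Measure TopologicalSpace
open scoped Manifold ContDiff Topology Matrix ENNReal

namespace Literature.Geometry.Riemannian

open Lorentzian Lorentzian.PseudoRiemannianMetric Literature.Analysis.Distribution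

variable {m : ℕ} {H : Type*} [TopologicalSpace H]
  {I : ModelWithCorners ℝ (EuclideanSpace ℝ (Fin m)) H}
  {M : Type*} [TopologicalSpace M] [ChartedSpace H M]

/-- The space-time model `ℝᵐ × ℝ`. -/
local notation "𝔼" => EuclideanSpace ℝ (Fin m) × ℝ
/-- The standard basis of `ℝᵐ`. -/
local notation "𝐛" => OrthonormalBasis.toBasis (EuclideanSpace.basisFun (Fin m) ℝ)

/-! ### Slice derivatives on `ℝᵐ × ℝ` -/

section Slices

/-- A partial derivative of a slice `y ↦ F (y, s)` is the derivative of `F` along `(v, 0)`.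
[folklore] -/
theorem fderiv_slice_left {F : 𝔼 → ℝ} {y : EuclideanSpace ℝ (Fin m)} {s : ℝ}
    (hF : DifferentiableAt ℝ F (y, s)) (v : EuclideanSpace ℝ (Fin m)) :
    fderiv ℝ (fun y' ↦ F (y', s)) y v = fderiv ℝ F (y, s) (v, 0) := by
  have h1 : HasFDerivAt (fun y' : EuclideanSpace ℝ (Fin m) ↦ ((y', s) : 𝔼))
      (ContinuousLinearMap.inl ℝ (EuclideanSpace ℝ (Fin m)) ℝ) y := hasFDerivAt_prodMk_left y s
  have h2 : HasFDerivAt (fun y' ↦ F (y', s))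
      ((fderiv ℝ F (y, s)).comp (ContinuousLinearMap.inl ℝ (EuclideanSpace ℝ (Fin m)) ℝ)) y :=
    hF.hasFDerivAt.comp y h1
  rw [h2.fderiv]
  rfl

/-- The time derivative of a slice `s ↦ F (y, s)` is the derivative of `F` along `(0, 1)`.
[folklore] -/
theorem deriv_slice_right {F : 𝔼 → ℝ} {y : EuclideanSpace ℝ (Fin m)} {s : ℝ}
    (hF : DifferentiableAt ℝ F (y, s)) :
    deriv (fun s' ↦ F (y, s')) s = fderiv ℝ F (y, s) (0, 1) := by
  have h1 : HasFDerivAt (fun s' : ℝ ↦ ((y, s') : 𝔼))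
      (ContinuousLinearMap.inr ℝ (EuclideanSpace ℝ (Fin m)) ℝ) s := hasFDerivAt_prodMk_right y s
  have h2 : HasFDerivAt (fun s' ↦ F (y, s'))
      ((fderiv ℝ F (y, s)).comp (ContinuousLinearMap.inr ℝ (EuclideanSpace ℝ (Fin m)) ℝ)) s :=
    hF.hasFDerivAt.comp s h1
  rw [h2.hasDerivAt.deriv]
  rfl

end Slices

/-! ### Zero extension of chart test functions on the product `M × ℝ` -/

section ZeroExtension

variable [T2Space M]

/-- **Zero extension of a space-time chart pull-back.** For `ψ` on `ℝᵐ × ℝ` with compact support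
inside `φ.target × ℝ` (`φ` the extended chart at `x`), the function
`ζ(p) = 1_{source × ℝ}(p) ψ(φ p.1, p.2)` agrees with `ψ ∘ (φ × id)` on `source × ℝ`, vanishes off
the compact set `(φ⁻¹ × id)(tsupport ψ)`, and `ζ (φ⁻¹ y, s) = ψ (y, s)` on the target. [folklore] -/
theorem tsupport_indicator_comp_extChartAt_prod_subset (x : M) {ψ : 𝔼 → ℝ}
    (hψc : HasCompactSupport ψ) (hψT : tsupport ψ ⊆ (extChartAt I x).target ×ˢ univ) :
    tsupport (((chartAt H x).source ×ˢ (univ : Set ℝ)).indicator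
        fun p : M × ℝ ↦ ψ (extChartAt I x p.1, p.2)) ⊆
      (fun q : 𝔼 ↦ ((extChartAt I x).symm q.1, q.2)) '' tsupport ψ ∧
    IsCompact ((fun q : 𝔼 ↦ ((extChartAt I x).symm q.1, q.2)) '' tsupport ψ) ∧
    (fun q : 𝔼 ↦ ((extChartAt I x).symm q.1, q.2)) '' tsupport ψ ⊆
      (chartAt H x).source ×ˢ (univ : Set ℝ) := by
  have hsrc : (chartAt H x).source = (extChartAt I x).source := (extChartAt_source I (x := x)).symm
  have hcont : ContinuousOn (fun q : 𝔼 ↦ ((extChartAt I x).symm q.1, q.2))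
      ((extChartAt I x).target ×ˢ univ) :=
    ((continuousOn_extChartAt_symm x).comp continuous_fst.continuousOn
      (fun q hq ↦ hq.1)).prodMk continuous_snd.continuousOn
  have hKc : IsCompact ((fun q : 𝔼 ↦ ((extChartAt I x).symm q.1, q.2)) '' tsupport ψ) :=
    hψc.isCompact.image_of_continuousOn (hcont.mono hψT)
  have hKS : (fun q : 𝔼 ↦ ((extChartAt I x).symm q.1, q.2)) '' tsupport ψ ⊆
      (chartAt H x).source ×ˢ (univ : Set ℝ) := by
    rintro _ ⟨q, hq, rfl⟩
    refine ⟨?_, mem_univ _⟩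
    rw [hsrc]
    exact (extChartAt I x).map_target (hψT hq).1
  refine ⟨closure_minimal (fun p hp ↦ ?_) hKc.isClosed, hKc, hKS⟩
  rw [mem_support] at hp
  by_cases hps : p ∈ (chartAt H x).source ×ˢ (univ : Set ℝ)
  · rw [indicator_of_mem hps] at hp
    have hps' : p.1 ∈ (extChartAt I x).source := hsrc ▸ hps.1
    refine ⟨(extChartAt I x p.1, p.2), subset_tsupport _ (mem_support.2 hp), ?_⟩
    simp only [(extChartAt I x).left_inv hps']
  · exact absurd (indicator_of_notMem hps _) hp

/-- The zero extension of `ψ ∘ (φ × id)` is `C^∞` on `M × ℝ` when `ψ` is `C^∞` with compact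
support in `φ.target × ℝ`. [folklore] -/
theorem contMDiff_indicator_comp_extChartAt_prod [IsManifold I ∞ M] (x : M)
    {ψ : 𝔼 → ℝ} (hψ : ContDiff ℝ ∞ ψ) (hψc : HasCompactSupport ψ)
    (hψT : tsupport ψ ⊆ (extChartAt I x).target ×ˢ univ) :
    ContMDiff (I.prod 𝓘(ℝ, ℝ)) 𝓘(ℝ, ℝ) ∞
      (((chartAt H x).source ×ˢ (univ : Set ℝ)).indicator
        fun p : M × ℝ ↦ ψ (extChartAt I x p.1, p.2)) := by
  obtain ⟨hts, -, hKS⟩ := tsupport_indicator_comp_extChartAt_prod_subset (I := I) x hψc hψT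
  have hopen : IsOpen ((chartAt H x).source ×ˢ (univ : Set ℝ)) :=
    (chartAt H x).open_source.prod isOpen_univ
  refine contMDiff_of_tsupport fun p hp ↦ ?_
  have hps : p ∈ (chartAt H x).source ×ˢ (univ : Set ℝ) := hKS (hts hp)
  have hev : ((chartAt H x).source ×ˢ (univ : Set ℝ)).indicator
      (fun p : M × ℝ ↦ ψ (extChartAt I x p.1, p.2)) =ᶠ[𝓝 p]
      fun p : M × ℝ ↦ ψ (extChartAt I x p.1, p.2) := by
    filter_upwards [hopen.mem_nhds hps] with q hq
    rw [indicator_of_mem hq]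
  refine ContMDiffAt.congr_of_eventuallyEq ?_ hev
  have hΦ : ContMDiffAt (I.prod 𝓘(ℝ, ℝ)) 𝓘(ℝ, 𝔼) ∞
      (fun p : M × ℝ ↦ ((extChartAt I x p.1, p.2) : 𝔼)) p := by
    have h1 : ContMDiffAt (I.prod 𝓘(ℝ, ℝ)) 𝓘(ℝ, EuclideanSpace ℝ (Fin m)) ∞
        (fun p : M × ℝ ↦ extChartAt I x p.1) p :=
      ((contMDiffOn_extChartAt (I := I) (n := ∞) (x := x)).contMDiffAt
        ((chartAt H x).open_source.mem_nhds hps.1)).comp p contMDiffAt_fst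
    exact h1.prodMk_space contMDiffAt_snd
  exact hψ.contMDiff.contMDiffAt.comp p hΦ

/-- The zero extension has compact support. [folklore] -/
theorem hasCompactSupport_indicator_comp_extChartAt_prod (x : M) {ψ : 𝔼 → ℝ}
    (hψc : HasCompactSupport ψ) (hψT : tsupport ψ ⊆ (extChartAt I x).target ×ˢ univ) :
    HasCompactSupport (((chartAt H x).source ×ˢ (univ : Set ℝ)).indicator
        fun p : M × ℝ ↦ ψ (extChartAt I x p.1, p.2)) := by
  obtain ⟨hts, hKc, -⟩ := tsupport_indicator_comp_extChartAt_prod_subset (I := I) x hψc hψT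
  exact hKc.of_isClosed_subset isClosed_closure hts

omit [T2Space M] in
/-- On `φ.target × ℝ` the zero extension composed with `φ⁻¹ × id` is `ψ`. [folklore] -/
theorem indicator_comp_extChartAt_prod_symm_apply (x : M) (ψ : 𝔼 → ℝ)
    {y : EuclideanSpace ℝ (Fin m)} (hy : y ∈ (extChartAt I x).target) (s : ℝ) :
    ((chartAt H x).source ×ˢ (univ : Set ℝ)).indicator
        (fun p : M × ℝ ↦ ψ (extChartAt I x p.1, p.2)) ((extChartAt I x).symm y, s) = ψ (y, s) := by
  have hys : (extChartAt I x).symm y ∈ (chartAt H x).source := by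
    rw [← extChartAt_source I]; exact (extChartAt I x).map_target hy
  rw [indicator_of_mem (show ((extChartAt I x).symm y, s) ∈ (chartAt H x).source ×ˢ (univ : Set ℝ)
    from ⟨hys, mem_univ _⟩)]
  simp only [(extChartAt I x).right_inv hy]

/-- The time support of the zero extension is that of `ψ`: if `tsupport ψ ⊆ φ.target × T` then
the zero extension is supported in `M × T`. [folklore] -/
theorem tsupport_indicator_comp_extChartAt_prod_subset_time (x : M) {ψ : 𝔼 → ℝ}
    (hψc : HasCompactSupport ψ) {T : Set ℝ}
    (hψT : tsupport ψ ⊆ (extChartAt I x).target ×ˢ T) :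
    tsupport (((chartAt H x).source ×ˢ (univ : Set ℝ)).indicator
        fun p : M × ℝ ↦ ψ (extChartAt I x p.1, p.2)) ⊆ univ ×ˢ T := by
  obtain ⟨hts, -, -⟩ := tsupport_indicator_comp_extChartAt_prod_subset (I := I) x hψc
    (hψT.trans (prod_mono le_rfl (subset_univ _)))
  refine hts.trans ?_
  rintro _ ⟨q, hq, rfl⟩
  exact ⟨mem_univ _, (hψT hq).2⟩

end ZeroExtension

/-! ### The Gram matrix in a chart: positivity -/

section Gram

variable [IsManifold I ∞ M] [I.Boundaryless]

omit [I.Boundaryless] in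
/-- The Gram matrix of a Riemannian metric in the coordinate frame is positive definite.
[folklore] -/
theorem posDef_chartGramMatrix'
    {g : PseudoRiemannianMetric I ∞ (EuclideanSpace ℝ (Fin m)) (TangentSpace I : M → Type _)}
    (hg : g.IsRiemannian) (x₀ : M) {y : EuclideanSpace ℝ (Fin m)}
    (hy : y ∈ (extChartAt I x₀).target) :
    (chartGramMatrix (g.toContMDiffRiemannianMetric hg) x₀ y).PosDef := by
  classical
  set p : M := (extChartAt I x₀).symm y with hp
  set e := trivializationAt (EuclideanSpace ℝ (Fin m)) (TangentSpace I) x₀ with he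
  have hps : p ∈ (chartAt H x₀).source := by
    rw [← extChartAt_source I]; exact (extChartAt I x₀).map_target hy
  have hpe : p ∈ e.baseSet := by rw [he, TangentBundle.trivializationAt_baseSet]; exact hps
  set v : Module.Basis (Fin m) ℝ (TangentSpace I p) := e.basisAt 𝐛 hpe with hv
  have hframe : ∀ i, e.localFrame 𝐛 i p = v i := fun i ↦ e.localFrame_apply_of_mem_baseSet 𝐛 hpe
  have hG : chartGramMatrix (g.toContMDiffRiemannianMetric hg) x₀ y =
      Matrix.of fun i j ↦ g.val p (v i) (v j) := by
    ext i j
    rw [chartGramMatrix_apply_eq_val_localFrame _ x₀ hy i j, Matrix.of_apply]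
    change g.val p (e.localFrame 𝐛 i p) (e.localFrame 𝐛 j p) = g.val p (v i) (v j)
    rw [hframe, hframe]
  rw [hG]
  refine posDef_of_forall_sum_pos (fun i j ↦ g.symm p _ _) fun c hc ↦ ?_
  have hne : ∑ i, c i • v i ≠ 0 := by
    intro h0
    apply hc
    exact v.equivFun.symm.injective (a₁ := c) (a₂ := 0)
      (by rw [Module.Basis.equivFun_symm_apply, h0, map_zero])
  have hexp : g.val p (∑ i, c i • v i) (∑ j, c j • v j) =
      ∑ i, ∑ j, g.val p (v i) (v j) * (c i * c j) := by
    simp only [_root_.map_sum, map_smul, _root_.sum_apply, _root_.smul_apply, smul_eq_mul]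
    refine Finset.sum_congr rfl fun i _ ↦ ?_
    rw [Finset.mul_sum]
    refine Finset.sum_congr rfl fun j _ ↦ ?_
    rw [g.symm p (v j) (v i)]
    ring
  rw [← hexp]
  exact hg p _ hne

omit [I.Boundaryless] in
/-- The entries of the chart Gram matrix are `C^∞` on the chart target (general model space).
[folklore] -/
theorem contDiffOn_chartGramMatrix_apply'
    (G₀ : ContMDiffRiemannianMetric I ∞ (EuclideanSpace ℝ (Fin m)) (TangentSpace I : M → Type _))
    (x₀ : M) (i j : Fin m) :
    ContDiffOn ℝ ∞ (fun y ↦ chartGramMatrix G₀ x₀ y i j) (extChartAt I x₀).target :=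
  (contDiffOn_gram_comp_extChartAt_symm 𝐛 (ofRiemannian G₀) i j).congr
    fun _ hy ↦ chartGramMatrix_apply_eq_val_localFrame G₀ x₀ hy i j

/-- The chart density `√det G` is `C^∞` on the chart target (general model space). [folklore] -/
theorem contDiffOn_sqrt_det_chartGramMatrix'
    (G₀ : ContMDiffRiemannianMetric I ∞ (EuclideanSpace ℝ (Fin m)) (TangentSpace I : M → Type _))
    (x₀ : M) :
    ContDiffOn ℝ ∞ (fun y ↦ Real.sqrt (chartGramMatrix G₀ x₀ y).det) (extChartAt I x₀).target := by
  have hT : IsOpen (extChartAt I x₀).target := isOpen_extChartAt_target x₀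
  have hdet : ContDiffOn ℝ ∞ (fun y ↦ (chartGramMatrix G₀ x₀ y).det) (extChartAt I x₀).target := by
    intro y hy
    have h1 := contMDiffAt_matrix_det (I := 𝓘(ℝ, EuclideanSpace ℝ (Fin m))) (k := ∞)
      (A := fun y ↦ chartGramMatrix G₀ x₀ y) (x₀ := y)
      (fun i j ↦ contMDiffAt_iff_contDiffAt.2
        ((contDiffOn_chartGramMatrix_apply' G₀ x₀ i j).contDiffAt (hT.mem_nhds hy)))
    exact (contMDiffAt_iff_contDiffAt.1 h1).contDiffWithinAt
  exact hdet.sqrt fun y hy ↦ (Real.sqrt_pos.1 (sqrt_det_chartGramMatrix_pos G₀ x₀ hy)).ne'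

omit [I.Boundaryless] in
/-- The coefficients `Aₖₗ = √det G · (G⁻¹)ₖₗ` of `√g Δ` are positive definite on the chart target.
[folklore] -/
theorem heatCoeff_chart_pos
    {g : PseudoRiemannianMetric I ∞ (EuclideanSpace ℝ (Fin m)) (TangentSpace I : M → Type _)}
    (hg : g.IsRiemannian) (x₀ : M) {y : EuclideanSpace ℝ (Fin m)}
    (hy : y ∈ (extChartAt I x₀).target) (v : Fin m → ℝ) (hv : v ≠ 0) :
    0 < ∑ k, ∑ l, Real.sqrt (chartGramMatrix (g.toContMDiffRiemannianMetric hg) x₀ y).det *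
      (chartGramMatrix (g.toContMDiffRiemannianMetric hg) x₀ y)⁻¹ k l * (v k * v l) := by
  classical
  have hP := (posDef_chartGramMatrix' hg x₀ hy).inv
  have hpos := hP.dotProduct_mulVec_pos hv
  have hρ : 0 < Real.sqrt (chartGramMatrix (g.toContMDiffRiemannianMetric hg) x₀ y).det :=
    sqrt_det_chartGramMatrix_pos _ x₀ hy
  have hsum : star v ⬝ᵥ ((chartGramMatrix (g.toContMDiffRiemannianMetric hg) x₀ y)⁻¹ *ᵥ v) =
      ∑ k, ∑ l, (chartGramMatrix (g.toContMDiffRiemannianMetric hg) x₀ y)⁻¹ k l * (v k * v l) := by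
    simp only [dotProduct, Matrix.mulVec, star_trivial, Finset.mul_sum]
    refine Finset.sum_congr rfl fun k _ ↦ Finset.sum_congr rfl fun l _ ↦ by ring
  rw [hsum] at hpos
  have : ∑ k, ∑ l, Real.sqrt (chartGramMatrix (g.toContMDiffRiemannianMetric hg) x₀ y).det *
      (chartGramMatrix (g.toContMDiffRiemannianMetric hg) x₀ y)⁻¹ k l * (v k * v l) =
      Real.sqrt (chartGramMatrix (g.toContMDiffRiemannianMetric hg) x₀ y).det *
        ∑ k, ∑ l, (chartGramMatrix (g.toContMDiffRiemannianMetric hg) x₀ y)⁻¹ k l * (v k * v l) := by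
    rw [Finset.mul_sum]
    refine Finset.sum_congr rfl fun k _ ↦ ?_
    rw [Finset.mul_sum]
    refine Finset.sum_congr rfl fun l _ ↦ by ring
  rw [this]
  exact mul_pos hρ hpos

end Gram

/-! ### Null sets and local integrability between `M × ℝ` and the space-time chart -/

section MeasureTransfer

variable [IsManifold I ∞ M] [I.Boundaryless] [T2Space M] [CompactSpace M]
  [MeasurableSpace M] [BorelSpace M]
  (G₀ : ContMDiffRiemannianMetric I ∞ (EuclideanSpace ℝ (Fin m)) (TangentSpace I : M → Type _))

omit [I.Boundaryless] in
/-- Null sets transfer from the chart target to the chart domain (the general-model form of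
`ae_comp_extChartAt_of_ae_target`: `φ_*(μ_h|source) = √g · vol|target ≪ vol`). [folklore] -/
theorem ae_source_of_ae_target (x : M)
    {P : EuclideanSpace ℝ (Fin m) → Prop}
    (hae : ∀ᵐ y ∂(volume : Measure (EuclideanSpace ℝ (Fin m))), P y) :
    ∀ᵐ p ∂riemannianMeasure G₀, p ∈ (extChartAt I x).source → P (extChartAt I x p) := by
  have hs : MeasurableSet (extChartAt I x).source := (isOpen_extChartAt_source x).measurableSet
  have h1 : ∀ᵐ y ∂((volume : Measure (EuclideanSpace ℝ (Fin m))).restrict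
      (extChartAt I x).target), P y := ae_restrict_of_ae hae
  have h2 : ∀ᵐ y ∂(((volume : Measure (EuclideanSpace ℝ (Fin m))).restrict
      (extChartAt I x).target).withDensity
        (fun y ↦ ENNReal.ofReal (Real.sqrt (chartGramMatrix G₀ x y).det))), P y :=
    (withDensity_absolutelyContinuous _ _).ae_le h1
  rw [← map_extChartAt_restrict_riemannianMeasure G₀ x] at h2
  have h3 := ae_of_ae_map (aemeasurable_extChartAt_restrict x (riemannianMeasure G₀)) h2
  rw [ae_restrict_iff' hs] at h3
  exact h3

omit [I.Boundaryless] in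
/-- **Null sets transfer from the space-time chart to `M × ℝ`**: a property holding Lebesgue-a.e.
on `ℝᵐ × ℝ` holds `(μ_h ⊗ ds)`-a.e. at `(φ p.1, p.2)` for `p.1` in the chart domain. [folklore] -/
theorem ae_prod_chart_of_ae_volume (x : M) {P : 𝔼 → Prop}
    (hae : ∀ᵐ q ∂(volume : Measure 𝔼), P q) :
    ∀ᵐ p ∂(riemannianMeasure G₀).prod (volume : Measure ℝ),
      p.1 ∈ (extChartAt I x).source → P (extChartAt I x p.1, p.2) := by
  classical
  -- a measurable null set containing the exceptional set
  obtain ⟨N, hNsub, hNm, hN0⟩ := exists_measurable_superset_of_null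
    (show (volume : Measure 𝔼) {q | ¬P q} = 0 from hae)
  have hvol : (volume : Measure 𝔼) =
      (volume : Measure (EuclideanSpace ℝ (Fin m))).prod (volume : Measure ℝ) := rfl
  rw [hvol] at hN0
  -- its slices are Lebesgue-null for a.e. `y`, hence for a.e. `p.1` in the chart domain
  have h1 : ∀ᵐ y ∂(volume : Measure (EuclideanSpace ℝ (Fin m))),
      (volume : Measure ℝ) (Prod.mk y ⁻¹' N) = 0 := measure_ae_null_of_prod_null hN0
  have h2 := ae_source_of_ae_target G₀ x h1
  -- the exceptional product set
  set S : Set (M × ℝ) := {p | p.1 ∈ (extChartAt I x).source ∧ (extChartAt I x p.1, p.2) ∈ N}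
    with hS
  have hsrc : MeasurableSet (extChartAt I x).source := (isOpen_extChartAt_source x).measurableSet
  have hSm : MeasurableSet S := by
    have hm : Measurable (((extChartAt I x).source ×ˢ (univ : Set ℝ)).piecewise
        (fun p : M × ℝ ↦ ((extChartAt I x p.1, p.2) : 𝔼)) fun _ ↦ (extChartAt I x x, 0)) := by
      refine ContinuousOn.measurable_piecewise ?_ continuousOn_const (hsrc.prod MeasurableSet.univ)
      exact ((continuousOn_extChartAt x).comp continuous_fst.continuousOn
        (fun p hp ↦ hp.1)).prodMk continuous_snd.continuousOn
    have hS' : S = ((extChartAt I x).source ×ˢ (univ : Set ℝ)) ∩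
        (((extChartAt I x).source ×ˢ (univ : Set ℝ)).piecewise
          (fun p : M × ℝ ↦ ((extChartAt I x p.1, p.2) : 𝔼)) fun _ ↦ (extChartAt I x x, 0)) ⁻¹' N := by
      ext p
      simp only [hS, mem_setOf_eq, mem_inter_iff, mem_prod, mem_univ, and_true, Set.mem_preimage]
      constructor
      · rintro ⟨hp, hpN⟩
        refine ⟨hp, ?_⟩
        rwa [piecewise_eq_of_mem _ _ _ (show p ∈ (extChartAt I x).source ×ˢ (univ : Set ℝ) from
          ⟨hp, mem_univ _⟩)]
      · rintro ⟨hp, hpN⟩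
        refine ⟨hp, ?_⟩
        rwa [piecewise_eq_of_mem _ _ _ (show p ∈ (extChartAt I x).source ×ˢ (univ : Set ℝ) from
          ⟨hp, mem_univ _⟩)] at hpN
    rw [hS']
    exact (hsrc.prod MeasurableSet.univ).inter (hm hNm)
  have hS0 : ((riemannianMeasure G₀).prod (volume : Measure ℝ)) S = 0 := by
    refine measure_prod_null_of_ae_null hSm ?_
    filter_upwards [h2] with p hp
    by_cases hps : p ∈ (extChartAt I x).source
    · have : Prod.mk p ⁻¹' S = Prod.mk (extChartAt I x p) ⁻¹' N := by
        ext t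
        simp only [hS, Set.mem_preimage, mem_setOf_eq]
        exact ⟨fun h ↦ h.2, fun h ↦ ⟨hps, h⟩⟩
      rw [this]
      exact hp hps
    · have : Prod.mk p ⁻¹' S = ∅ := by
        ext t
        simp only [hS, Set.mem_preimage, mem_setOf_eq, mem_empty_iff_false, iff_false, not_and]
        exact fun h _ ↦ hps h
      rw [this, measure_empty, Pi.zero_apply]
  rw [← compl_mem_ae_iff] at hS0
  filter_upwards [hS0] with p hp hps
  by_contra hP
  exact hp ⟨hps, hNsub hP⟩

/-- **Local integrability transfers to the space-time chart**: if `u` is locally integrable on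
`M × T` (`T` open) for `μ_h ⊗ ds`, then `(y, s) ↦ u(φ⁻¹ y, s)` is locally integrable on
`φ.target × T` for Lebesgue measure (the chart density is bounded below on compact parts of the
target). [folklore] -/
theorem locallyIntegrableOn_comp_chart_prod (x : M)
    {T : Set ℝ} (hT : IsOpen T) {u : M × ℝ → ℝ} (hum : Measurable u)
    (hu : LocallyIntegrableOn u (univ ×ˢ T) ((riemannianMeasure G₀).prod (volume : Measure ℝ))) :
    LocallyIntegrableOn (fun q : 𝔼 ↦ u ((extChartAt I x).symm q.1, q.2))
      ((extChartAt I x).target ×ˢ T) (volume : Measure 𝔼) := by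
  set φ := extChartAt I x with hφ
  have hTo : IsOpen (φ.target ×ˢ T) := (isOpen_extChartAt_target x).prod hT
  have hΨ : ContinuousOn (fun q : 𝔼 ↦ ((φ.symm q.1, q.2) : M × ℝ)) (φ.target ×ˢ (Set.univ : Set ℝ)) :=
    ((continuousOn_extChartAt_symm x).comp continuous_fst.continuousOn
      (fun q hq ↦ hq.1)).prodMk continuous_snd.continuousOn
  rw [locallyIntegrableOn_iff hTo.isLocallyClosed]
  intro K hKsub hK
  -- measurability
  have hmeas : AEStronglyMeasurable (fun q : 𝔼 ↦ u (φ.symm q.1, q.2))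
      ((volume : Measure 𝔼).restrict K) := by
    have h1 : AEMeasurable (fun q : 𝔼 ↦ ((φ.symm q.1, q.2) : M × ℝ))
        ((volume : Measure 𝔼).restrict K) :=
      (hΨ.mono (hKsub.trans (prod_mono le_rfl (subset_univ _)))).aemeasurable hK.measurableSet
    exact (hum.comp_aemeasurable h1).aestronglyMeasurable
  refine ⟨hmeas, ?_⟩
  -- a lower bound for the chart density on the projection of `K`
  set K₁ : Set (EuclideanSpace ℝ (Fin m)) := Prod.fst '' K with hK₁
  have hK₁c : IsCompact K₁ := hK.image continuous_fst
  have hK₁T : K₁ ⊆ φ.target := by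
    rintro _ ⟨q, hq, rfl⟩; exact (hKsub hq).1
  have hρc : ContinuousOn (fun y ↦ Real.sqrt (chartGramMatrix G₀ x y).det) φ.target :=
    (contDiffOn_sqrt_det_chartGramMatrix' G₀ x).continuousOn
  obtain ⟨lam, hlam, hlamle⟩ : ∃ lam : ℝ, 0 < lam ∧
      ∀ y ∈ K₁, lam ≤ Real.sqrt (chartGramMatrix G₀ x y).det := by
    rcases K₁.eq_empty_or_nonempty with hKe | hKne
    · exact ⟨1, one_pos, fun y hy ↦ by rw [hKe] at hy; exact hy.elim⟩
    · obtain ⟨y₀, hy₀, hmin⟩ := hK₁c.exists_isMinOn hKne (hρc.mono hK₁T)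
      exact ⟨_, sqrt_det_chartGramMatrix_pos G₀ x (hK₁T hy₀), fun y hy ↦ hmin hy⟩
  -- the compact preimage of `K` in `M × ℝ`
  set K' : Set (M × ℝ) := (fun q : 𝔼 ↦ ((φ.symm q.1, q.2) : M × ℝ)) '' K with hK'
  have hK'c : IsCompact K' :=
    hK.image_of_continuousOn (hΨ.mono (hKsub.trans (prod_mono le_rfl (subset_univ _))))
  have hK'T : K' ⊆ (Set.univ : Set M) ×ˢ T := by
    rintro _ ⟨q, hq, rfl⟩; exact ⟨mem_univ _, (hKsub hq).2⟩
  have hfin : ∫⁻ p in K', ‖u p‖ₑ ∂(riemannianMeasure G₀).prod (volume : Measure ℝ) < ⊤ :=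
    (hu.integrableOn_compact_subset hK'T hK'c).2
  -- Tonelli on both sides and the chart formula slice by slice
  have hsrc : MeasurableSet φ.source := (isOpen_extChartAt_source x).measurableSet
  have hKm : MeasurableSet K := hK.measurableSet
  have hK'm : MeasurableSet K' := hK'c.measurableSet
  haveI : IsFiniteMeasure (riemannianMeasure G₀) := isFiniteMeasure_riemannianMeasure G₀
  -- the slice inequalities
  have hslice : ∀ s : ℝ, ∫⁻ y, K.indicator (fun q : 𝔼 ↦ ‖u (φ.symm q.1, q.2)‖ₑ) (y, s) ≤
      ENNReal.ofReal (1 / lam) *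
        ∫⁻ p, K'.indicator (fun p : M × ℝ ↦ ‖u p‖ₑ) (p, s) ∂riemannianMeasure G₀ := by
    intro s
    -- the manifold-side slice integrand is supported in the chart domain
    set F : M → ℝ≥0∞ := fun p ↦ K'.indicator (fun p : M × ℝ ↦ ‖u p‖ₑ) (p, s) with hF
    have hFm : Measurable F :=
      (hum.enorm.indicator hK'm).comp (measurable_id.prodMk measurable_const)
    have hFsupp : support F ⊆ φ.source := by
      intro p hp
      rw [mem_support, hF] at hp
      have hpK : (p, s) ∈ K' := by
        by_contra h'; exact hp (indicator_of_notMem h' _)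
      obtain ⟨q, hq, hpq⟩ := hpK
      have : p = φ.symm q.1 := (congrArg Prod.fst hpq).symm
      rw [this]
      exact φ.map_target (hKsub hq).1
    have key : ∀ y, K.indicator (fun q : 𝔼 ↦ ‖u (φ.symm q.1, q.2)‖ₑ) (y, s) ≤
        ENNReal.ofReal (1 / lam) * (φ.target).indicator
          (fun y ↦ F (φ.symm y) * ENNReal.ofReal (Real.sqrt (chartGramMatrix G₀ x y).det)) y := by
      intro y
      by_cases hyK : (y, s) ∈ K
      · have hyT : y ∈ φ.target := (hKsub hyK).1
        have hyK₁ : y ∈ K₁ := ⟨(y, s), hyK, rfl⟩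
        have hyK' : ((φ.symm y, s) : M × ℝ) ∈ K' := ⟨(y, s), hyK, rfl⟩
        rw [indicator_of_mem hyK, indicator_of_mem hyT, hF]
        dsimp only
        rw [indicator_of_mem hyK']
        have hρ := hlamle y hyK₁
        calc ‖u (φ.symm y, s)‖ₑ
            = ENNReal.ofReal (1 / lam) * ENNReal.ofReal lam * ‖u (φ.symm y, s)‖ₑ := by
              rw [← ENNReal.ofReal_mul (by positivity), one_div_mul_cancel hlam.ne',
                ENNReal.ofReal_one, one_mul]
          _ = ENNReal.ofReal (1 / lam) * (‖u (φ.symm y, s)‖ₑ * ENNReal.ofReal lam) := by ring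
          _ ≤ ENNReal.ofReal (1 / lam) * (‖u (φ.symm y, s)‖ₑ *
              ENNReal.ofReal (Real.sqrt (chartGramMatrix G₀ x y).det)) :=
              mul_le_mul_right (mul_le_mul_right (ENNReal.ofReal_le_ofReal hρ) _) _
      · rw [indicator_of_notMem hyK]
        exact zero_le
    calc ∫⁻ y, K.indicator (fun q : 𝔼 ↦ ‖u (φ.symm q.1, q.2)‖ₑ) (y, s)
        ≤ ∫⁻ y, ENNReal.ofReal (1 / lam) * (φ.target).indicator
            (fun y ↦ F (φ.symm y) * ENNReal.ofReal (Real.sqrt (chartGramMatrix G₀ x y).det)) y :=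
          lintegral_mono key
      _ = ENNReal.ofReal (1 / lam) * ∫⁻ y in φ.target,
            F (φ.symm y) * ENNReal.ofReal (Real.sqrt (chartGramMatrix G₀ x y).det) := by
          rw [lintegral_const_mul' _ _ ENNReal.ofReal_ne_top,
            lintegral_indicator (measurableSet_extChartAt_target x)]
      _ = ENNReal.ofReal (1 / lam) * ∫⁻ p, F p ∂riemannianMeasure G₀ := by
          rw [← lintegral_eq_lintegral_chart G₀ x hFm hFsupp]
  have hAE : AEMeasurable (K.indicator fun q : 𝔼 ↦ ‖u (φ.symm q.1, q.2)‖ₑ) (volume : Measure 𝔼) :=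
    (aemeasurable_indicator_iff hKm).2 hmeas.aemeasurable.enorm
  calc ∫⁻ q in K, ‖u (φ.symm q.1, q.2)‖ₑ
      = ∫⁻ q, K.indicator (fun q : 𝔼 ↦ ‖u (φ.symm q.1, q.2)‖ₑ) q := (lintegral_indicator hKm _).symm
    _ = ∫⁻ s, ∫⁻ y, K.indicator (fun q : 𝔼 ↦ ‖u (φ.symm q.1, q.2)‖ₑ) (y, s) := by
        rw [show (volume : Measure 𝔼) =
          (volume : Measure (EuclideanSpace ℝ (Fin m))).prod (volume : Measure ℝ) from rfl] at hAE ⊢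
        exact lintegral_prod_symm _ hAE
    _ ≤ ∫⁻ s, ENNReal.ofReal (1 / lam) *
          ∫⁻ p, K'.indicator (fun p : M × ℝ ↦ ‖u p‖ₑ) (p, s) ∂riemannianMeasure G₀ :=
        lintegral_mono hslice
    _ = ENNReal.ofReal (1 / lam) *
          ∫⁻ p, K'.indicator (fun p : M × ℝ ↦ ‖u p‖ₑ) p ∂(riemannianMeasure G₀).prod volume := by
        rw [lintegral_const_mul' _ _ ENNReal.ofReal_ne_top, lintegral_prod_symm]
        exact ((hum.enorm.indicator hK'm).aemeasurable :)
    _ = ENNReal.ofReal (1 / lam) * ∫⁻ p in K', ‖u p‖ₑ ∂(riemannianMeasure G₀).prod volume := by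
        rw [lintegral_indicator hK'm]
    _ < ⊤ := ENNReal.mul_lt_top ENNReal.ofReal_lt_top hfin

end MeasureTransfer

/-! ### Patching local smooth representatives on an open set -/

section Patching

variable {EX : Type*} [NormedAddCommGroup EX] [NormedSpace ℝ EX] {HX : Type*} [TopologicalSpace HX]
  {JX : ModelWithCorners ℝ EX HX} {X : Type*} [TopologicalSpace X] [ChartedSpace HX X]
  [MeasurableSpace X] [BorelSpace X]

/-- **Patching**: if on an open set `O` a function agrees, near every point, a.e. with a smooth
function, then it agrees a.e. on `O` with a function smooth on `O` (continuous representatives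
agree on overlaps because the measure charges open sets; countable subcover). [folklore] -/
theorem exists_contMDiffOn_ae_eq_of_forall_exists_nhds [SecondCountableTopology X]
    {μ : Measure X} [μ.IsOpenPosMeasure] {O : Set X} {u : X → ℝ}
    (hloc : ∀ x ∈ O, ∃ V : Set X, IsOpen V ∧ x ∈ V ∧ V ⊆ O ∧ ∃ w : X → ℝ,
      ContMDiffOn JX 𝓘(ℝ, ℝ) ∞ w V ∧ ∀ᵐ p ∂μ, p ∈ V → u p = w p) :
    ∃ v : X → ℝ, ContMDiffOn JX 𝓘(ℝ, ℝ) ∞ v O ∧ ∀ᵐ p ∂μ, p ∈ O → u p = v p := by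
  classical
  choose V hVo hxV hVO w hw hae using hloc
  -- two representatives agree on the overlap of their domains
  have hagree : ∀ x (hx : x ∈ O) z (hz : z ∈ O), EqOn (w x hx) (w z hz) (V x hx ∩ V z hz) := by
    intro x hx z hz
    refine Measure.eqOn_open_of_ae_eq (μ := μ) ?_ ((hVo x hx).inter (hVo z hz))
      ((hw x hx).continuousOn.mono inter_subset_left)
      ((hw z hz).continuousOn.mono inter_subset_right)
    rw [Filter.EventuallyEq, ae_restrict_iff' ((hVo x hx).inter (hVo z hz)).measurableSet]
    filter_upwards [hae x hx, hae z hz] with p hpx hpz hp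
    rw [← hpx hp.1, ← hpz hp.2]
  refine ⟨fun p ↦ if hp : p ∈ O then w p hp p else 0, ?_, ?_⟩
  · intro x hx
    have hev : (fun p ↦ if hp : p ∈ O then w p hp p else 0) =ᶠ[𝓝 x] w x hx := by
      filter_upwards [(hVo x hx).mem_nhds (hxV x hx)] with p hp
      have hpO : p ∈ O := hVO x hx hp
      rw [dif_pos hpO]
      exact hagree p hpO x hx ⟨hxV p hpO, hp⟩
    exact (((hw x hx).contMDiffAt ((hVo x hx).mem_nhds (hxV x hx))).congr_of_eventuallyEq
      hev).contMDiffWithinAt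
  · obtain ⟨t, htO, htc, ht⟩ := TopologicalSpace.countable_cover_nhdsWithin
      (f := fun x ↦ if hx : x ∈ O then V x hx else ∅) (s := O)
      (fun x hx ↦ by
        rw [dif_pos hx]
        exact mem_nhdsWithin_of_mem_nhds ((hVo x hx).mem_nhds (hxV x hx)))
    have hall : ∀ᵐ p ∂μ, ∀ x ∈ t, ∀ hx : x ∈ O, p ∈ V x hx → u p = w x hx p :=
      (ae_ball_iff htc).2 fun x hxt ↦ (ae_all_iff.2 fun hx ↦ hae x hx)
    filter_upwards [hall] with p hp hpO
    have hpt : p ∈ ⋃ x ∈ t, (if hx : x ∈ O then V x hx else ∅) := ht hpO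
    obtain ⟨x, hxt, hpx⟩ := mem_iUnion₂.1 hpt
    have hxO : x ∈ O := htO hxt
    rw [dif_pos hxO] at hpx
    rw [hp x hxt hxO hpx, dif_pos hpO]
    exact hagree x hxO p hpO ⟨hpx, hxV p hpO⟩

end Patching

/-! ### Integrals of locally integrable functions against test functions -/

section TestIntegrable

variable {Y : Type*} [TopologicalSpace Y] [MeasurableSpace Y] [OpensMeasurableSpace Y]
  [T2Space Y]

/-- A locally integrable function on an open set times a continuous function with compact support
inside that set is integrable. [folklore] -/
theorem integrable_mul_of_locallyIntegrableOn {μ : Measure Y} {O : Set Y} {u T : Y → ℝ}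
    (hu : LocallyIntegrableOn u O μ) (hT : Continuous T) (hTc : HasCompactSupport T)
    (hTO : tsupport T ⊆ O) : Integrable (fun p ↦ u p * T p) μ := by
  have hK : IsCompact (tsupport T) := hTc
  have h1 : IntegrableOn (fun p ↦ u p * T p) (tsupport T) μ :=
    (hu.integrableOn_compact_subset hTO hK).mul_continuousOn hT.continuousOn hK
  refine (integrableOn_iff_integrable_of_support_subset ?_).1 h1
  intro p hp
  rw [mem_support] at hp
  exact subset_tsupport _ (right_ne_zero_of_mul hp)

end TestIntegrable

/-! ### The very weak heat equation read in a space-time chart -/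

section ChartIdentity

variable [IsManifold I ∞ M] [I.Boundaryless] [T2Space M] [CompactSpace M]
  [MeasurableSpace M] [BorelSpace M]
  {h : ℝ → PseudoRiemannianMetric I ∞ (EuclideanSpace ℝ (Fin m)) (TangentSpace I : M → Type _)}
  {g₀ : PseudoRiemannianMetric I ∞ (EuclideanSpace ℝ (Fin m)) (TangentSpace I : M → Type _)}

/-- `heatTranspose` vanishes off the support of the test function. [folklore] -/
theorem heatTranspose_eq_zero_of_notMem_tsupport {A : Fin m → Fin m → 𝔼 → ℝ} {J q : 𝔼 → ℝ}
    {ψ : 𝔼 → ℝ} {p : 𝔼} (hp : p ∉ tsupport ψ) : heatTranspose A J q ψ p = 0 := by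
  have hev : ψ =ᶠ[𝓝 p] 0 := notMem_tsupport_iff_eventuallyEq.1 hp
  have hev' : ∀ᶠ z in 𝓝 p, z ∉ tsupport ψ := (isClosed_tsupport ψ).isOpen_compl.mem_nhds hp
  have hJψ : (fun z ↦ J z * ψ z) =ᶠ[𝓝 p] fun _ ↦ 0 := by
    filter_upwards [hev] with z hz; rw [hz, Pi.zero_apply, mul_zero]
  have hAψ : ∀ k, (fun z ↦ ∑ l, A k l z * fderiv ℝ ψ z (𝐛 l, 0)) =ᶠ[𝓝 p] fun _ ↦ 0 := by
    intro k
    filter_upwards [hev'] with z hz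
    refine Finset.sum_eq_zero fun l _ ↦ ?_
    rw [fderiv_apply_eq_zero_of_notMem_tsupport hz, mul_zero]
  have h0 : ∀ k, fderiv ℝ (fun z ↦ ∑ l, A k l z * fderiv ℝ ψ z (𝐛 l, 0)) p = 0 := fun k ↦ by
    rw [(hAψ k).fderiv_eq]; exact fderiv_const_apply 0
  have h0' : fderiv ℝ (fun z ↦ J z * ψ z) p = 0 := by
    rw [hJψ.fderiv_eq]; exact fderiv_const_apply 0
  simp only [heatTranspose_apply, h0, h0', image_eq_zero_of_notMem_tsupport hp, mul_zero, add_zero]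
  simp

/-- A smooth function on an open set vanishing off a compact subset, read as a function on the
whole space, is smooth with compact support contained in the compact set (wrapper of
`contDiff_of_contDiffOn_of_eq_zero`). [folklore] -/
theorem heatTranspose_contDiff_of_tsupport {O : Set 𝔼} (hO : IsOpen O)
    {A : Fin m → Fin m → 𝔼 → ℝ} (hA : ∀ k l, ContDiffOn ℝ ∞ (A k l) O)
    {J q : 𝔼 → ℝ} (hJ : ContDiffOn ℝ ∞ J O) (hq : ContDiffOn ℝ ∞ q O)
    {ψ : 𝔼 → ℝ} (hψ : ContDiff ℝ ∞ ψ) (hψc : HasCompactSupport ψ) (hψO : tsupport ψ ⊆ O) :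
    ContDiff ℝ ∞ (heatTranspose A J q ψ) ∧ HasCompactSupport (heatTranspose A J q ψ) ∧
      tsupport (heatTranspose A J q ψ) ⊆ tsupport ψ := by
  have h0 : ∀ p ∉ tsupport ψ, heatTranspose A J q ψ p = 0 := fun p hp ↦
    heatTranspose_eq_zero_of_notMem_tsupport hp
  have hon : ContDiffOn ℝ ∞ (heatTranspose A J q ψ) O := by
    have hdψ : ∀ v : 𝔼, ContDiff ℝ ∞ fun z ↦ fderiv ℝ ψ z v := fun v ↦
      (hψ.fderiv_right (m := ∞) (by exact_mod_cast le_top)).clm_apply contDiff_const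
    have h1 : ContDiffOn ℝ ∞ (fun p ↦ fderiv ℝ (fun z ↦ J z * ψ z) p ((0 : EuclideanSpace ℝ (Fin m)), (1 : ℝ)))
        O := ((hJ.mul hψ.contDiffOn).fderiv_of_isOpen hO (by exact_mod_cast le_top)).clm_apply
          contDiffOn_const
    have h2 : ∀ k, ContDiffOn ℝ ∞ (fun p ↦ fderiv ℝ (fun z ↦ ∑ l, A k l z * fderiv ℝ ψ z (𝐛 l, 0)) p
        ((𝐛 k : EuclideanSpace ℝ (Fin m)), (0 : ℝ))) O := fun k ↦
      (((ContDiffOn.sum fun l _ ↦ (hA k l).mul (hdψ _).contDiffOn)).fderiv_of_isOpen hO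
        (by exact_mod_cast le_top)).clm_apply contDiffOn_const
    have : heatTranspose A J q ψ = fun p ↦
        -(fderiv ℝ (fun z ↦ J z * ψ z) p ((0 : EuclideanSpace ℝ (Fin m)), (1 : ℝ))) -
          (∑ k, fderiv ℝ (fun z ↦ ∑ l, A k l z * fderiv ℝ ψ z (𝐛 l, 0)) p (𝐛 k, 0)) +
          q p * ψ p := funext fun p ↦ heatTranspose_apply A J q ψ p
    rw [this]
    exact (h1.neg.sub (ContDiffOn.sum fun k _ ↦ h2 k)).add (hq.mul hψ.contDiffOn)
  refine ⟨contDiff_of_contDiffOn_of_eq_zero hO hψc hψO hon h0, ?_, ?_⟩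
  · exact HasCompactSupport.intro hψc h0
  · exact closure_minimal (fun p hp ↦ by_contra fun h' ↦ hp (h0 p h')) (isClosed_tsupport ψ)

/-- **The very weak heat equation read in a space-time chart.** Let `h(s)` be a family of
Riemannian metrics on the closed manifold `M`, `C^∞` on `M × ℝ`, `g₀` a Riemannian reference
metric with density ratio `ρ(s, x) = dV_{h(s)}/dV_{g₀}`, `Q, G` smooth on `M × ℝ`, and let the
measurable `u : M × ℝ → ℝ` satisfy, for all smooth `ζ` compactly supported in `M × T`,
`∫ u · (−∂ₛ(ρζ) − ρ Δ_{h(s)}ζ + ρQζ) d(V_{g₀} ⊗ ds) = ∫ ρ G ζ d(V_{g₀} ⊗ ds)`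
(the very weak form of `∂ₛu = Δ_{h(s)}u − Qu + G`). Then in the product chart `φ × id` at `x₀`
the representative `ū(y, s) = u(φ⁻¹y, s)` satisfies
`∫ ū · heatTranspose A J q ψ dy ds = ∫ F ψ dy ds` for every smooth `ψ` compactly supported in
`φ.target × T`, with `J = √det h(s)ᵢⱼ`, `A = J h(s)⁻¹`, `q = J Q`, `F = J G` — the divergence
form `√g Δ_h = ∑ ∂ₖ(√g gᵏˡ∂ₗ)` of the coordinate Laplacian (`coordLaplacian_mul_sqrt_det_eq_sum_fderiv`,
`dalembertian_eq_sum_localFrame`), the chart formula `dV_{g₀} = √det (g₀)ᵢⱼ dy`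
(`integral_eq_integral_chart`) and `ρ √det (g₀)ᵢⱼ = √det h(s)ᵢⱼ`
(`densityRatio_mul_sqrt_det_chartGramMatrix`), slice by slice in time (Fubini).
[cite: Chavel2006, §III.3 (III.3.6) and §III.7] -/
theorem integral_heatTranspose_chart_of_veryWeak
    (hh : IsContMDiffFamilyOn ∞ h univ) (hR : ∀ s, (h s).IsRiemannian) (hR₀ : g₀.IsRiemannian)
    {Q G : ℝ → M → ℝ} (hQ : ContMDiff (I.prod 𝓘(ℝ, ℝ)) 𝓘(ℝ, ℝ) ∞ fun p : M × ℝ ↦ Q p.2 p.1)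
    (hG : ContMDiff (I.prod 𝓘(ℝ, ℝ)) 𝓘(ℝ, ℝ) ∞ fun p : M × ℝ ↦ G p.2 p.1)
    {T : Set ℝ} (hT : IsOpen T) {u : M × ℝ → ℝ} (hum : Measurable u)
    (hu : LocallyIntegrableOn u (univ ×ˢ T) (g₀.riemVolume.prod (volume : Measure ℝ)))
    (hweak : ∀ ζ : M × ℝ → ℝ, ContMDiff (I.prod 𝓘(ℝ, ℝ)) 𝓘(ℝ, ℝ) ∞ ζ → HasCompactSupport ζ →
      tsupport ζ ⊆ univ ×ˢ T →
      ∫ p, u p * (-(deriv (fun s ↦ (h s).densityRatio g₀ p.1 * ζ (p.1, s)) p.2) -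
          (h p.2).densityRatio g₀ p.1 * (h p.2).laplaceBeltrami (fun x ↦ ζ (x, p.2)) p.1 +
          (h p.2).densityRatio g₀ p.1 * Q p.2 p.1 * ζ p) ∂g₀.riemVolume.prod (volume : Measure ℝ) =
        ∫ p, (h p.2).densityRatio g₀ p.1 * G p.2 p.1 * ζ p ∂g₀.riemVolume.prod (volume : Measure ℝ))
    (x₀ : M) (Jc qc Fc : 𝔼 → ℝ) (Ac : Fin m → Fin m → 𝔼 → ℝ)
    (hJc : ∀ q, Jc q = Real.sqrt (chartGramMatrix ((h q.2).toContMDiffRiemannianMetric (hR q.2)) x₀ q.1).det)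
    (hAc : ∀ k l q, Ac k l q =
      Jc q * (chartGramMatrix ((h q.2).toContMDiffRiemannianMetric (hR q.2)) x₀ q.1)⁻¹ k l)
    (hqc : ∀ q, qc q = Jc q * Q q.2 ((extChartAt I x₀).symm q.1))
    (hFc : ∀ q, Fc q = Jc q * G q.2 ((extChartAt I x₀).symm q.1))
    {ψ : 𝔼 → ℝ} (hψ : ContDiff ℝ ∞ ψ) (hψc : HasCompactSupport ψ)
    (hψT : tsupport ψ ⊆ (extChartAt I x₀).target ×ˢ T) :
    ∫ q, u ((extChartAt I x₀).symm q.1, q.2) * heatTranspose Ac Jc qc ψ q =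
      ∫ q, Fc q * ψ q := by
  classical
  -- notation
  set φ := extChartAt I x₀ with hφ
  set e := trivializationAt (EuclideanSpace ℝ (Fin m)) (TangentSpace I) x₀ with he
  set μ₀ : Measure M := g₀.riemVolume with hμ₀
  have hV : IsOpen φ.target := isOpen_extChartAt_target x₀
  have hO : IsOpen (φ.target ×ˢ (univ : Set ℝ)) := hV.prod isOpen_univ
  haveI : IsFiniteMeasure μ₀ := by
    rw [hμ₀, riemVolume_eq hR₀]; exact isFiniteMeasure_riemannianMeasure _
  have hψT' : tsupport ψ ⊆ φ.target ×ˢ (univ : Set ℝ) := hψT.trans (prod_mono le_rfl (subset_univ _))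
  have hsrc : (chartAt H x₀).source = φ.source := (extChartAt_source (I := I) (x := x₀)).symm
  -- the density ratio and its chart identity
  set ρ : M × ℝ → ℝ := fun p ↦ (h p.2).densityRatio g₀ p.1 with hρ
  have hρs : ContMDiff (I.prod 𝓘(ℝ, ℝ)) 𝓘(ℝ, ℝ) ∞ ρ := by
    have h1 := hh.contMDiffOn_densityRatio (fun s _ ↦ hR s) hR₀
    rw [univ_prod_univ] at h1
    exact contMDiffOn_univ.1 h1
  have hρJ : ∀ (y : EuclideanSpace ℝ (Fin m)) (s : ℝ), y ∈ φ.target →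
      ρ (φ.symm y, s) * Real.sqrt (chartGramMatrix (g₀.toContMDiffRiemannianMetric hR₀) x₀ y).det =
        Jc (y, s) := by
    intro y s hy
    rw [hJc]
    exact densityRatio_mul_sqrt_det_chartGramMatrix (hR s) hR₀ x₀ hy
  have hJ0pos : ∀ y ∈ φ.target,
      0 < Real.sqrt (chartGramMatrix (g₀.toContMDiffRiemannianMetric hR₀) x₀ y).det :=
    fun y hy ↦ sqrt_det_chartGramMatrix_pos _ x₀ hy
  -- the Gram family in the chart and the smoothness of the chart data on `φ.target × ℝ`
  set Gh : 𝔼 → Fin m → Fin m → ℝ := fun q i j ↦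
    chartGramMatrix ((h q.2).toContMDiffRiemannianMetric (hR q.2)) x₀ q.1 i j with hGh
  have hofG : ∀ q, Matrix.of (Gh q) = chartGramMatrix ((h q.2).toContMDiffRiemannianMetric (hR q.2)) x₀ q.1 :=
    fun q ↦ by ext i j; rfl
  have hGval : ∀ q ∈ φ.target ×ˢ (univ : Set ℝ), ∀ i j, Gh q i j =
      (h q.2).val (φ.symm q.1) (e.localFrame 𝐛 i (φ.symm q.1)) (e.localFrame 𝐛 j (φ.symm q.1)) := by
    intro q hq i j
    exact chartGramMatrix_apply_eq_val_localFrame _ x₀ hq.1 i j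
  have hGs : ∀ i j, ContDiffOn ℝ ∞ (fun q ↦ Gh q i j) (φ.target ×ˢ (univ : Set ℝ)) := fun i j ↦
    (hh.contDiffOn_gram_chart x₀ 𝐛 i j).congr fun q hq ↦ hGval q hq i j
  have hGsymm : ∀ q i j, Gh q i j = Gh q j i := fun q i j ↦ chartGramMatrix_apply_comm _ x₀ q.1 i j
  have hdetpos : ∀ q ∈ φ.target ×ˢ (univ : Set ℝ), 0 < (Matrix.of (Gh q)).det := fun q hq ↦ by
    rw [hofG]; exact Real.sqrt_pos.1 (sqrt_det_chartGramMatrix_pos _ x₀ hq.1)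
  have hGdet : ContDiffOn ℝ ∞ (fun q ↦ (Matrix.of (Gh q)).det) (φ.target ×ˢ (univ : Set ℝ)) := by
    intro q hq
    have h1 := contMDiffWithinAt_matrix_det (J := 𝓘(ℝ, 𝔼)) (k := ∞)
      (A := fun q ↦ Matrix.of (Gh q)) (s := φ.target ×ˢ (univ : Set ℝ)) (x₀ := q)
      (fun i j ↦ contMDiffWithinAt_iff_contDiffWithinAt.2 (hGs i j q hq))
    exact contMDiffWithinAt_iff_contDiffWithinAt.1 h1
  have hJcs : ContDiffOn ℝ ∞ Jc (φ.target ×ˢ (univ : Set ℝ)) := by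
    have : Jc = fun q ↦ Real.sqrt (Matrix.of (Gh q)).det := funext fun q ↦ by rw [hJc, hofG]
    rw [this]
    exact hGdet.sqrt fun q hq ↦ (hdetpos q hq).ne'
  have hGinv : ∀ i l, ContDiffOn ℝ ∞ (fun q ↦ (Matrix.of (Gh q))⁻¹ i l) (φ.target ×ˢ (univ : Set ℝ)) := by
    intro i l q hq
    have h1 := contMDiffWithinAt_matrix_inv (J := 𝓘(ℝ, 𝔼)) (k := ∞)
      (A := fun q ↦ Matrix.of (Gh q)) (s := φ.target ×ˢ (univ : Set ℝ)) (x₀ := q)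
      (fun i j ↦ contMDiffWithinAt_iff_contDiffWithinAt.2 (hGs i j q hq)) (hdetpos q hq).ne' i l
    exact contMDiffWithinAt_iff_contDiffWithinAt.1 h1
  have hAcs : ∀ k l, ContDiffOn ℝ ∞ (Ac k l) (φ.target ×ˢ (univ : Set ℝ)) := by
    intro k l
    have : Ac k l = fun q ↦ Jc q * (Matrix.of (Gh q))⁻¹ k l := funext fun q ↦ by rw [hAc, hofG]
    rw [this]; exact hJcs.mul (hGinv k l)
  have hQch : ContDiffOn ℝ ∞ (fun q : 𝔼 ↦ Q q.2 (φ.symm q.1)) (φ.target ×ˢ (univ : Set ℝ)) :=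
    contDiffOn_time_chart (k := (⊤ : ℕ∞)) hQ.contMDiffOn x₀
  have hGch : ContDiffOn ℝ ∞ (fun q : 𝔼 ↦ G q.2 (φ.symm q.1)) (φ.target ×ˢ (univ : Set ℝ)) :=
    contDiffOn_time_chart (k := (⊤ : ℕ∞)) hG.contMDiffOn x₀
  have hqcs : ContDiffOn ℝ ∞ qc (φ.target ×ˢ (univ : Set ℝ)) := by
    have : qc = fun q ↦ Jc q * Q q.2 (φ.symm q.1) := funext hqc
    rw [this]; exact hJcs.mul hQch
  -- the test function on `M × ℝ`
  obtain ⟨ζ, hζdef⟩ : ∃ ζ : M × ℝ → ℝ, ζ = ((chartAt H x₀).source ×ˢ (univ : Set ℝ)).indicator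
      fun p : M × ℝ ↦ ψ (extChartAt I x₀ p.1, p.2) := ⟨_, rfl⟩
  have hζs : ContMDiff (I.prod 𝓘(ℝ, ℝ)) 𝓘(ℝ, ℝ) ∞ ζ := by
    rw [hζdef]; exact contMDiff_indicator_comp_extChartAt_prod x₀ hψ hψc hψT'
  have hζc : HasCompactSupport ζ := by
    rw [hζdef]; exact hasCompactSupport_indicator_comp_extChartAt_prod x₀ hψc hψT'
  have hζT : tsupport ζ ⊆ univ ×ˢ T := by
    rw [hζdef]; exact tsupport_indicator_comp_extChartAt_prod_subset_time x₀ hψc hψT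
  obtain ⟨hts, hKc, hKS⟩ := tsupport_indicator_comp_extChartAt_prod_subset (I := I) x₀ hψc hψT'
  have hζsupp : tsupport ζ ⊆ φ.source ×ˢ (univ : Set ℝ) := by
    rw [hζdef, ← hsrc]; exact hts.trans hKS
  have hζψ : ∀ (y : EuclideanSpace ℝ (Fin m)) (s : ℝ), y ∈ φ.target → ζ (φ.symm y, s) = ψ (y, s) := by
    intro y s hy; rw [hζdef]; exact indicator_comp_extChartAt_prod_symm_apply x₀ ψ hy s
  -- the weak identity for `ζ`
  have hW := hweak ζ hζs hζc hζT
  -- abbreviations for the manifold-side integrands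
  set Tζ : M × ℝ → ℝ := fun p ↦ -(deriv (fun s ↦ (h s).densityRatio g₀ p.1 * ζ (p.1, s)) p.2) -
      (h p.2).densityRatio g₀ p.1 * (h p.2).laplaceBeltrami (fun x ↦ ζ (x, p.2)) p.1 +
      (h p.2).densityRatio g₀ p.1 * Q p.2 p.1 * ζ p with hTζ
  set Rζ : M × ℝ → ℝ := fun p ↦ (h p.2).densityRatio g₀ p.1 * G p.2 p.1 * ζ p with hRζ
  -- smoothness of the manifold-side integrands
  have hρζ : ContMDiff (I.prod 𝓘(ℝ, ℝ)) 𝓘(ℝ, ℝ) ∞ fun p : M × ℝ ↦ ρ p * ζ p := hρs.mul hζs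
  have hDt : ContMDiff (I.prod 𝓘(ℝ, ℝ)) 𝓘(ℝ, ℝ) ∞
      fun p : M × ℝ ↦ deriv (fun s ↦ (h s).densityRatio g₀ p.1 * ζ (p.1, s)) p.2 := by
    have h1 := contMDiffOn_derivWithin_time_of_uniqueDiffOn (I := I) (M := M)
      (u := fun s x ↦ (h s).densityRatio g₀ x * ζ (x, s)) (S := univ) uniqueDiffOn_univ
      (by rw [univ_prod_univ]; exact hρζ.contMDiffOn)
    rw [univ_prod_univ] at h1
    simpa only [derivWithin_univ] using contMDiffOn_univ.1 h1
  have hΔ : ContMDiff (I.prod 𝓘(ℝ, ℝ)) 𝓘(ℝ, ℝ) ∞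
      fun p : M × ℝ ↦ (h p.2).laplaceBeltrami (fun x ↦ ζ (x, p.2)) p.1 := by
    have h1 := hh.contMDiffOn_laplaceBeltrami uniqueDiffOn_univ (f := fun s x ↦ ζ (x, s))
      (by rw [univ_prod_univ]; exact hζs.contMDiffOn)
    rw [univ_prod_univ] at h1
    exact contMDiffOn_univ.1 h1
  have hTζs : ContMDiff (I.prod 𝓘(ℝ, ℝ)) 𝓘(ℝ, ℝ) ∞ Tζ :=
    (hDt.neg.sub (hρs.mul hΔ)).add ((hρs.mul hQ).mul hζs)
  have hRζs : ContMDiff (I.prod 𝓘(ℝ, ℝ)) 𝓘(ℝ, ℝ) ∞ Rζ := (hρs.mul hG).mul hζs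
  -- both vanish off `tsupport ζ`
  have hslice0 : ∀ p : M × ℝ, p ∉ tsupport ζ → p.1 ∉ tsupport (fun x ↦ ζ (x, p.2)) := by
    rintro ⟨x, s⟩ hp hx
    have hev : ζ =ᶠ[𝓝 (x, s)] 0 := notMem_tsupport_iff_eventuallyEq.1 hp
    have : (fun x' ↦ ζ (x', s)) =ᶠ[𝓝 x] 0 := by
      have hc : ContinuousAt (fun x' : M ↦ ((x', s) : M × ℝ)) x := by fun_prop
      exact hc.eventually hev
    exact (notMem_tsupport_iff_eventuallyEq.2 this) hx
  have hT0 : ∀ p ∉ tsupport ζ, Tζ p = 0 := by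
    rintro ⟨x, s⟩ hp
    have hev : ζ =ᶠ[𝓝 (x, s)] 0 := notMem_tsupport_iff_eventuallyEq.1 hp
    have hd : deriv (fun s' ↦ (h s').densityRatio g₀ x * ζ (x, s')) s = 0 := by
      have hc : ContinuousAt (fun s' : ℝ ↦ ((x, s') : M × ℝ)) s := by fun_prop
      have h1 : (fun s' ↦ (h s').densityRatio g₀ x * ζ (x, s')) =ᶠ[𝓝 s] fun _ ↦ 0 := by
        filter_upwards [hc.eventually hev] with s' hs'
        rw [hs', Pi.zero_apply, mul_zero]
      rw [h1.deriv_eq]; exact deriv_const s 0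
    haveI := (h s).hasLeviCivita
    have hΔ0 : (h s).laplaceBeltrami (fun x' ↦ ζ (x', s)) x = 0 := by
      rw [laplaceBeltrami_eq_dalembertian]
      exact dalembertian_eq_zero_of_notMem_tsupport _ (hslice0 (x, s) hp)
    have hζ0 : ζ (x, s) = 0 := image_eq_zero_of_notMem_tsupport hp
    simp only [hTζ, hd, hΔ0, hζ0, mul_zero, neg_zero, sub_zero, add_zero]
  have hR0 : ∀ p ∉ tsupport ζ, Rζ p = 0 := fun p hp ↦ by
    simp only [hRζ, image_eq_zero_of_notMem_tsupport hp, mul_zero]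
  -- integrability on `M × ℝ` and Fubini
  have hTζsupp : tsupport Tζ ⊆ tsupport ζ :=
    closure_minimal (fun p hp ↦ by_contra fun h' ↦ hp (hT0 p h')) (isClosed_tsupport ζ)
  have hRζsupp : tsupport Rζ ⊆ tsupport ζ :=
    closure_minimal (fun p hp ↦ by_contra fun h' ↦ hp (hR0 p h')) (isClosed_tsupport ζ)
  have hTζc : HasCompactSupport Tζ := hζc.of_isClosed_subset (isClosed_tsupport _) hTζsupp
  have hRζc : HasCompactSupport Rζ := hζc.of_isClosed_subset (isClosed_tsupport _) hRζsupp
  have hint : Integrable (fun p ↦ u p * Tζ p) (μ₀.prod (volume : Measure ℝ)) :=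
    integrable_mul_of_locallyIntegrableOn hu hTζs.continuous hTζc (hTζsupp.trans hζT)
  -- local integrability of the chart representative
  have hū : LocallyIntegrableOn (fun q : 𝔼 ↦ u (φ.symm q.1, q.2)) (φ.target ×ˢ T)
      (volume : Measure 𝔼) := by
    have hu' : LocallyIntegrableOn u (univ ×ˢ T)
        ((riemannianMeasure (g₀.toContMDiffRiemannianMetric hR₀)).prod (volume : Measure ℝ)) := by
      rw [← riemVolume_eq hR₀]; exact hu
    exact locallyIntegrableOn_comp_chart_prod (g₀.toContMDiffRiemannianMetric hR₀) x₀ hT hum hu'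
  -- the chart-side transpose is smooth with compact support in `tsupport ψ`
  obtain ⟨hHs, hHc, hHsupp⟩ := heatTranspose_contDiff_of_tsupport hO hAcs hJcs hqcs hψ hψc hψT'
  -- (1) the slice identity for the left-hand side
  have hLslice : ∀ s : ℝ, ∫ x, u (x, s) * Tζ (x, s) ∂μ₀ =
      ∫ y, u (φ.symm y, s) * heatTranspose Ac Jc qc ψ (y, s) := by
    intro s
    -- the integrand on `M` is supported in the chart domain
    have hmeas : Measurable fun x ↦ u (x, s) * Tζ (x, s) :=
      (hum.comp (measurable_id.prodMk measurable_const)).mul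
        (hTζs.continuous.comp (continuous_id.prodMk continuous_const)).measurable
    have hsupp : support (fun x ↦ u (x, s) * Tζ (x, s)) ⊆ φ.source := by
      intro x hx
      rw [mem_support] at hx
      have hx' : Tζ (x, s) ≠ 0 := right_ne_zero_of_mul hx
      have : (x, s) ∈ tsupport ζ := by_contra fun h' ↦ hx' (hT0 _ h')
      exact (hζsupp this).1
    rw [hμ₀, riemVolume_eq hR₀, integral_eq_integral_chart _ x₀ hmeas hsupp]
    -- pointwise identity on the target
    have hpt : ∀ y ∈ φ.target,
        Real.sqrt (chartGramMatrix (g₀.toContMDiffRiemannianMetric hR₀) x₀ y).det •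
          (u (φ.symm y, s) * Tζ (φ.symm y, s)) =
        u (φ.symm y, s) * heatTranspose Ac Jc qc ψ (y, s) := by
      intro y hy
      have hq : ((y, s) : 𝔼) ∈ φ.target ×ˢ (univ : Set ℝ) := ⟨hy, mem_univ _⟩
      have hyx : φ.symm y ∈ (chartAt H x₀).source := by rw [hsrc]; exact φ.map_target hy
      set J0 : ℝ := Real.sqrt (chartGramMatrix (g₀.toContMDiffRiemannianMetric hR₀) x₀ y).det
        with hJ0
      have hJ0p : 0 < J0 := hJ0pos y hy
      -- (a) the time-derivative term
      have ha : J0 * deriv (fun s' ↦ (h s').densityRatio g₀ (φ.symm y) * ζ (φ.symm y, s')) s =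
          fderiv ℝ (fun z ↦ Jc z * ψ z) (y, s) ((0 : EuclideanSpace ℝ (Fin m)), (1 : ℝ)) := by
        have hfun : (fun s' ↦ (h s').densityRatio g₀ (φ.symm y) * ζ (φ.symm y, s')) =
            fun s' ↦ J0⁻¹ * (Jc (y, s') * ψ (y, s')) := by
          funext s'
          have h1 := hρJ y s' hy
          simp only [hρ] at h1
          rw [hζψ y s' hy, ← h1, hJ0]
          have hne : Real.sqrt (chartGramMatrix (g₀.toContMDiffRiemannianMetric hR₀) x₀ y).det ≠ 0 :=
            (hJ0pos y hy).ne'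
          field_simp
        rw [hfun, deriv_const_mul_field', ← mul_assoc, mul_inv_cancel₀ hJ0p.ne', one_mul]
        exact deriv_slice_right (((hJcs.mul hψ.contDiffOn).contDiffAt (hO.mem_nhds hq)).differentiableAt
          (by simp))
      -- (b) the Laplacian term
      have hb : J0 * ((h s).densityRatio g₀ (φ.symm y) *
          (h s).laplaceBeltrami (fun x ↦ ζ (x, s)) (φ.symm y)) =
          ∑ k, fderiv ℝ (fun z ↦ ∑ l, Ac k l z * fderiv ℝ ψ z (𝐛 l, 0)) (y, s) (𝐛 k, 0) := by
        -- the slice functions in the chart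
        set Ghs : EuclideanSpace ℝ (Fin m) → Fin m → Fin m → ℝ := fun z i j ↦ Gh (z, s) i j with hGhs
        set ψs : EuclideanSpace ℝ (Fin m) → ℝ := fun z ↦ ψ (z, s) with hψs
        have hψss : ContDiff ℝ ∞ ψs := hψ.comp (contDiff_id.prodMk contDiff_const)
        have hψs2 : ContDiff ℝ 2 ψs := hψss.of_le (by norm_cast)
        have hGhs_s : ∀ i j, ContDiffOn ℝ ∞ (fun z ↦ Ghs z i j) φ.target := fun i j ↦
          (hGs i j).comp (contDiffOn_id.prodMk contDiffOn_const) fun z hz ↦ ⟨hz, mem_univ _⟩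
        have hGhs_pi : ContDiffOn ℝ ∞ Ghs φ.target :=
          contDiffOn_pi.2 fun i ↦ contDiffOn_pi.2 fun j ↦ hGhs_s i j
        have hGy : HasFDerivAt Ghs (fderiv ℝ Ghs y) y :=
          ((hGhs_pi.contDiffAt (hV.mem_nhds hy)).differentiableAt (by simp)).hasFDerivAt
        have hf2y : HasFDerivAt (fun z ↦ fderiv ℝ ψs z) (fderiv ℝ (fderiv ℝ ψs) y) y :=
          (((hψs2.fderiv_right (m := 1) (by norm_num)).contDiffAt).differentiableAt
            one_ne_zero).hasFDerivAt
        have hζslice : CMDiff ∞ (fun x ↦ ζ (x, s)) := hζs.comp (contMDiff_id.prodMk contMDiff_const)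
        have hζ2 : CMDiffAt 2 (fun x ↦ ζ (x, s)) (φ.symm y) := (hζslice.of_le (by norm_cast)) _
        haveI := (h s).hasLeviCivita
        have hL := dalembertian_eq_sum_localFrame (h s) 𝐛 hyx hζ2 (Gh := Ghs) (fh := ψs) (by
            rw [φ.right_inv hy]
            filter_upwards [hV.mem_nhds hy] with z hz
            intro i j
            exact hGval (z, s) ⟨hz, mem_univ _⟩ i j) (by
            rw [φ.right_inv hy]
            filter_upwards [hV.mem_nhds hy] with z hz
            simp only [hψs, Function.comp_apply]
            exact (hζψ z s hz).symm)
        rw [φ.right_inv hy] at hL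
        have hdety : 0 < (Matrix.of (Ghs y)).det := hdetpos (y, s) hq
        have hGsymm' : ∀ z i j, Ghs z i j = Ghs z j i := fun z i j ↦ hGsymm (z, s) i j
        have hC := Literature.Analysis.Calculus.coordLaplacian_mul_sqrt_det_eq_sum_fderiv 𝐛 hGy
          hGsymm' hdety hf2y
        rw [(h s).laplaceBeltrami_eq_dalembertian, hL]
        simp only [Literature.Analysis.Calculus.fderiv_apply_apply_eq hGy] at hC ⊢
        -- `J0 * ρ = Jc (y, s) = √det (Ghs y)`
        have hJρ : J0 * (h s).densityRatio g₀ (φ.symm y) = Real.sqrt (Matrix.of (Ghs y)).det := by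
          rw [mul_comm]
          have := hρJ y s hy
          simp only [hρ] at this
          rw [this, hJc, hofG]
        rw [← mul_assoc, hJρ, hC]
        -- convert slice derivatives to space-time derivatives
        refine Finset.sum_congr rfl fun k _ ↦ ?_
        have hWk : ContDiffOn ℝ ∞ (fun z ↦ ∑ l, Ac k l z * fderiv ℝ ψ z (𝐛 l, 0))
            (φ.target ×ˢ (univ : Set ℝ)) :=
          ContDiffOn.sum fun l _ ↦ (hAcs k l).mul
            ((hψ.fderiv_right (m := ∞) (by exact_mod_cast le_top)).clm_apply contDiff_const).contDiffOn
        have hev : (fun z ↦ Real.sqrt (Matrix.of (Ghs z)).det *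
            ∑ l, (Matrix.of (Ghs z))⁻¹ k l * fderiv ℝ ψs z (𝐛 l)) =ᶠ[𝓝 y]
            fun z ↦ ∑ l, Ac k l (z, s) * fderiv ℝ ψ (z, s) (𝐛 l, 0) := by
          filter_upwards [hV.mem_nhds hy] with z hz
          rw [Finset.mul_sum]
          refine Finset.sum_congr rfl fun l _ ↦ ?_
          rw [hAc, hJc, hofG, fderiv_slice_left (hψ.differentiable (by simp) _) (𝐛 l), mul_assoc]
        rw [hev.fderiv_eq]
        exact fderiv_slice_left ((hWk.contDiffAt (hO.mem_nhds hq)).differentiableAt (by simp)) (𝐛 k)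
      -- (c) the potential term
      have hc : J0 * ((h s).densityRatio g₀ (φ.symm y) * Q s (φ.symm y) * ζ (φ.symm y, s)) =
          qc (y, s) * ψ (y, s) := by
        rw [hqc, hζψ y s hy, ← hρJ y s hy]
        simp only [hρ]
        ring
      -- assemble
      rw [heatTranspose_apply, smul_eq_mul]
      simp only [hTζ]
      have : J0 * (-(deriv (fun s' ↦ (h s').densityRatio g₀ (φ.symm y) * ζ (φ.symm y, s')) s) -
          (h s).densityRatio g₀ (φ.symm y) * (h s).laplaceBeltrami (fun x ↦ ζ (x, s)) (φ.symm y) +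
          (h s).densityRatio g₀ (φ.symm y) * Q s (φ.symm y) * ζ (φ.symm y, s)) =
          -(J0 * deriv (fun s' ↦ (h s').densityRatio g₀ (φ.symm y) * ζ (φ.symm y, s')) s) -
            J0 * ((h s).densityRatio g₀ (φ.symm y) *
              (h s).laplaceBeltrami (fun x ↦ ζ (x, s)) (φ.symm y)) +
            J0 * ((h s).densityRatio g₀ (φ.symm y) * Q s (φ.symm y) * ζ (φ.symm y, s)) := by ring
      rw [mul_left_comm, this, ha, hb, hc]
    rw [setIntegral_congr_fun (measurableSet_extChartAt_target x₀) hpt,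
      setIntegral_eq_integral_of_forall_compl_eq_zero]
    intro y hy
    have : ((y, s) : 𝔼) ∉ tsupport ψ := fun h' ↦ hy (hψT' h').1
    rw [heatTranspose_eq_zero_of_notMem_tsupport this, mul_zero]
  -- (2) the slice identity for the right-hand side
  have hRslice : ∀ s : ℝ, ∫ x, Rζ (x, s) ∂μ₀ = ∫ y, Fc (y, s) * ψ (y, s) := by
    intro s
    have hmeas : Measurable fun x ↦ Rζ (x, s) :=
      (hRζs.continuous.comp (continuous_id.prodMk continuous_const)).measurable
    have hsupp : support (fun x ↦ Rζ (x, s)) ⊆ φ.source := by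
      intro x hx
      rw [mem_support] at hx
      have : (x, s) ∈ tsupport ζ := by_contra fun h' ↦ hx (hR0 _ h')
      exact (hζsupp this).1
    rw [hμ₀, riemVolume_eq hR₀, integral_eq_integral_chart _ x₀ hmeas hsupp]
    have hpt : ∀ y ∈ φ.target,
        Real.sqrt (chartGramMatrix (g₀.toContMDiffRiemannianMetric hR₀) x₀ y).det • Rζ (φ.symm y, s) =
        Fc (y, s) * ψ (y, s) := by
      intro y hy
      have h1 := hρJ y s hy
      simp only [hρ] at h1
      simp only [hRζ, smul_eq_mul]
      rw [hζψ y s hy, hFc, ← h1]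
      ring
    rw [setIntegral_congr_fun (measurableSet_extChartAt_target x₀) hpt,
      setIntegral_eq_integral_of_forall_compl_eq_zero]
    intro y hy
    have : ((y, s) : 𝔼) ∉ tsupport ψ := fun h' ↦ hy (hψT' h').1
    rw [image_eq_zero_of_notMem_tsupport this, mul_zero]
  -- (3) Fubini on both sides
  have hLHS : ∫ p, u p * Tζ p ∂μ₀.prod (volume : Measure ℝ) =
      ∫ q, u (φ.symm q.1, q.2) * heatTranspose Ac Jc qc ψ q := by
    rw [integral_prod_symm _ hint]
    simp_rw [hLslice]
    have hint' : Integrable (fun q : 𝔼 ↦ u (φ.symm q.1, q.2) * heatTranspose Ac Jc qc ψ q)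
        (volume : Measure 𝔼) :=
      integrable_mul_of_locallyIntegrableOn hū hHs.continuous hHc (hHsupp.trans hψT)
    rw [show (volume : Measure 𝔼) = (volume : Measure (EuclideanSpace ℝ (Fin m))).prod
      (volume : Measure ℝ) from rfl] at hint' ⊢
    rw [integral_prod_symm _ hint']
  have hRHS : ∫ p, Rζ p ∂μ₀.prod (volume : Measure ℝ) = ∫ q, Fc q * ψ q := by
    have hintR : Integrable Rζ (μ₀.prod (volume : Measure ℝ)) :=
      hRζs.continuous.integrable_of_hasCompactSupport hRζc
    rw [integral_prod_symm _ hintR]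
    simp_rw [hRslice]
    have hFcs : ContDiffOn ℝ ∞ Fc (φ.target ×ˢ (univ : Set ℝ)) := by
      have : Fc = fun q ↦ Jc q * G q.2 (φ.symm q.1) := funext hFc
      rw [this]; exact hJcs.mul hGch
    have hFψ : ContDiff ℝ ∞ fun q ↦ Fc q * ψ q :=
      contDiff_of_contDiffOn_of_eq_zero hO hψc hψT' (hFcs.mul hψ.contDiffOn)
        fun q hq ↦ by rw [image_eq_zero_of_notMem_tsupport hq, mul_zero]
    have hFψc : HasCompactSupport fun q ↦ Fc q * ψ q := hψc.mul_left
    have hint' : Integrable (fun q : 𝔼 ↦ Fc q * ψ q) (volume : Measure 𝔼) :=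
      hFψ.continuous.integrable_of_hasCompactSupport hFψc
    rw [show (volume : Measure 𝔼) = (volume : Measure (EuclideanSpace ℝ (Fin m))).prod
      (volume : Measure ℝ) from rfl] at hint' ⊢
    rw [integral_prod_symm _ hint']
  rw [← hLHS, ← hRHS]
  exact hW

end ChartIdentity

/-! ### Interior regularity on `M × T` -/

section Regularity

variable [IsManifold I ∞ M] [I.Boundaryless] [T2Space M] [CompactSpace M]
  [SecondCountableTopology M] [MeasurableSpace M] [BorelSpace M]
  {h : ℝ → PseudoRiemannianMetric I ∞ (EuclideanSpace ℝ (Fin m)) (TangentSpace I : M → Type _)}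
  {g₀ : PseudoRiemannianMetric I ∞ (EuclideanSpace ℝ (Fin m)) (TangentSpace I : M → Type _)}

/-- **Interior regularity of very weak solutions of the linear heat equation on a closed
manifold.** Let `h(s)` be a family of Riemannian metrics on the closed manifold `M` (modelled on
`ℝᵐ`), `C^∞` on `M × ℝ`, `g₀` a Riemannian reference metric with density ratio
`ρ = dV_{h(s)}/dV_{g₀}`, `Q, G` smooth on `M × ℝ`, `T ⊆ ℝ` open, and let the measurable
`u : M × ℝ → ℝ`, locally integrable on `M × T` for `dV_{g₀} ⊗ ds`, satisfy
`∫ u · (−∂ₛ(ρζ) − ρ Δ_{h(s)}ζ + ρQζ) = ∫ ρ G ζ` for all smooth `ζ` compactly supported in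
`M × T` — the very weak form of **`∂ₛu = Δ_{h(s)}u − Qu + G`**. Then `u` agrees a.e. on `M × T`
with a function `C^∞` on `M × T`. Proof: in each space-time chart the representative is a very
weak solution of a parabolic equation with smooth coefficients
(`integral_heatTranspose_chart_of_veryWeak`), hence locally a.e. smooth by Hörmander's theorem
(`exists_contDiffOn_ae_eq_of_heat_veryWeak`, from `hormander1967_thm11_proof`); the local
representatives are pulled back (`ae_prod_chart_of_ae_volume`) and patched
(`exists_contMDiffOn_ae_eq_of_forall_exists_nhds`). [cite: Hormander1967, Thm 1.1 and p. 147] -/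
theorem exists_contMDiffOn_ae_eq_of_linearHeat_veryWeak
    (hh : IsContMDiffFamilyOn ∞ h univ) (hR : ∀ s, (h s).IsRiemannian) (hR₀ : g₀.IsRiemannian)
    {Q G : ℝ → M → ℝ} (hQ : ContMDiff (I.prod 𝓘(ℝ, ℝ)) 𝓘(ℝ, ℝ) ∞ fun p : M × ℝ ↦ Q p.2 p.1)
    (hG : ContMDiff (I.prod 𝓘(ℝ, ℝ)) 𝓘(ℝ, ℝ) ∞ fun p : M × ℝ ↦ G p.2 p.1)
    {T : Set ℝ} (hT : IsOpen T) {u : M × ℝ → ℝ} (hum : Measurable u)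
    (hu : LocallyIntegrableOn u (univ ×ˢ T) (g₀.riemVolume.prod (volume : Measure ℝ)))
    (hweak : ∀ ζ : M × ℝ → ℝ, ContMDiff (I.prod 𝓘(ℝ, ℝ)) 𝓘(ℝ, ℝ) ∞ ζ → HasCompactSupport ζ →
      tsupport ζ ⊆ univ ×ˢ T →
      ∫ p, u p * (-(deriv (fun s ↦ (h s).densityRatio g₀ p.1 * ζ (p.1, s)) p.2) -
          (h p.2).densityRatio g₀ p.1 * (h p.2).laplaceBeltrami (fun x ↦ ζ (x, p.2)) p.1 +
          (h p.2).densityRatio g₀ p.1 * Q p.2 p.1 * ζ p) ∂g₀.riemVolume.prod (volume : Measure ℝ) =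
        ∫ p, (h p.2).densityRatio g₀ p.1 * G p.2 p.1 * ζ p ∂g₀.riemVolume.prod (volume : Measure ℝ)) :
    ∃ v : M × ℝ → ℝ, ContMDiffOn (I.prod 𝓘(ℝ, ℝ)) 𝓘(ℝ, ℝ) ∞ v (univ ×ˢ T) ∧
      ∀ᵐ p ∂g₀.riemVolume.prod (volume : Measure ℝ), p ∈ univ ×ˢ T → u p = v p := by
  classical
  set μ₀ : Measure M := g₀.riemVolume with hμ₀
  haveI : IsFiniteMeasure μ₀ := by
    rw [hμ₀, riemVolume_eq hR₀]; exact isFiniteMeasure_riemannianMeasure _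
  haveI : μ₀.IsOpenPosMeasure := by
    rw [hμ₀, riemVolume_eq hR₀]; exact isOpenPosMeasure_riemannianMeasure _
  haveI : (μ₀.prod (volume : Measure ℝ)).IsOpenPosMeasure := prod.instIsOpenPosMeasure
  refine exists_contMDiffOn_ae_eq_of_forall_exists_nhds (JX := I.prod 𝓘(ℝ, ℝ))
    (μ := μ₀.prod (volume : Measure ℝ)) fun p₀ hp₀ ↦ ?_
  obtain ⟨x₀, s₀⟩ := p₀
  have hs₀ : s₀ ∈ T := hp₀.2
  set φ := extChartAt I x₀ with hφ
  have hV : IsOpen φ.target := isOpen_extChartAt_target x₀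
  have hO : IsOpen (φ.target ×ˢ (univ : Set ℝ)) := hV.prod isOpen_univ
  have hΩ : IsOpen (φ.target ×ˢ T) := hV.prod hT
  have hΩO : φ.target ×ˢ T ⊆ φ.target ×ˢ (univ : Set ℝ) := prod_mono le_rfl (subset_univ _)
  -- the chart data
  set Jc : 𝔼 → ℝ := fun q ↦
    Real.sqrt (chartGramMatrix ((h q.2).toContMDiffRiemannianMetric (hR q.2)) x₀ q.1).det with hJc
  set Ac : Fin m → Fin m → 𝔼 → ℝ := fun k l q ↦
    Jc q * (chartGramMatrix ((h q.2).toContMDiffRiemannianMetric (hR q.2)) x₀ q.1)⁻¹ k l with hAc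
  set qc : 𝔼 → ℝ := fun q ↦ Jc q * Q q.2 (φ.symm q.1) with hqc
  set Fc : 𝔼 → ℝ := fun q ↦ Jc q * G q.2 (φ.symm q.1) with hFc
  -- smoothness of the chart data (as in the chart identity)
  set e := trivializationAt (EuclideanSpace ℝ (Fin m)) (TangentSpace I) x₀ with he
  set Gh : 𝔼 → Fin m → Fin m → ℝ := fun q i j ↦
    chartGramMatrix ((h q.2).toContMDiffRiemannianMetric (hR q.2)) x₀ q.1 i j with hGh
  have hofG : ∀ q, Matrix.of (Gh q) =
      chartGramMatrix ((h q.2).toContMDiffRiemannianMetric (hR q.2)) x₀ q.1 := fun q ↦ by ext i j; rfl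
  have hGs : ∀ i j, ContDiffOn ℝ ∞ (fun q ↦ Gh q i j) (φ.target ×ˢ (univ : Set ℝ)) := fun i j ↦
    (hh.contDiffOn_gram_chart x₀ 𝐛 i j).congr fun q hq ↦
      chartGramMatrix_apply_eq_val_localFrame _ x₀ hq.1 i j
  have hdetpos : ∀ q ∈ φ.target ×ˢ (univ : Set ℝ), 0 < (Matrix.of (Gh q)).det := fun q hq ↦ by
    rw [hofG]; exact Real.sqrt_pos.1 (sqrt_det_chartGramMatrix_pos _ x₀ hq.1)
  have hGdet : ContDiffOn ℝ ∞ (fun q ↦ (Matrix.of (Gh q)).det) (φ.target ×ˢ (univ : Set ℝ)) := by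
    intro q hq
    have h1 := contMDiffWithinAt_matrix_det (J := 𝓘(ℝ, 𝔼)) (k := ∞)
      (A := fun q ↦ Matrix.of (Gh q)) (s := φ.target ×ˢ (univ : Set ℝ)) (x₀ := q)
      (fun i j ↦ contMDiffWithinAt_iff_contDiffWithinAt.2 (hGs i j q hq))
    exact contMDiffWithinAt_iff_contDiffWithinAt.1 h1
  have hJcs : ContDiffOn ℝ ∞ Jc (φ.target ×ˢ (univ : Set ℝ)) := by
    have : Jc = fun q ↦ Real.sqrt (Matrix.of (Gh q)).det := funext fun q ↦ by rw [hJc, hofG]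
    rw [this]
    exact hGdet.sqrt fun q hq ↦ (hdetpos q hq).ne'
  have hGinv : ∀ i l, ContDiffOn ℝ ∞ (fun q ↦ (Matrix.of (Gh q))⁻¹ i l) (φ.target ×ˢ (univ : Set ℝ)) := by
    intro i l q hq
    have h1 := contMDiffWithinAt_matrix_inv (J := 𝓘(ℝ, 𝔼)) (k := ∞)
      (A := fun q ↦ Matrix.of (Gh q)) (s := φ.target ×ˢ (univ : Set ℝ)) (x₀ := q)
      (fun i j ↦ contMDiffWithinAt_iff_contDiffWithinAt.2 (hGs i j q hq)) (hdetpos q hq).ne' i l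
    exact contMDiffWithinAt_iff_contDiffWithinAt.1 h1
  have hAcs : ∀ k l, ContDiffOn ℝ ∞ (Ac k l) (φ.target ×ˢ (univ : Set ℝ)) := by
    intro k l
    have : Ac k l = fun q ↦ Jc q * (Matrix.of (Gh q))⁻¹ k l := funext fun q ↦ by rw [hAc, hofG]
    rw [this]; exact hJcs.mul (hGinv k l)
  have hqcs : ContDiffOn ℝ ∞ qc (φ.target ×ˢ (univ : Set ℝ)) :=
    hJcs.mul (contDiffOn_time_chart (k := (⊤ : ℕ∞)) hQ.contMDiffOn x₀)
  have hFcs : ContDiffOn ℝ ∞ Fc (φ.target ×ˢ (univ : Set ℝ)) :=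
    hJcs.mul (contDiffOn_time_chart (k := (⊤ : ℕ∞)) hG.contMDiffOn x₀)
  -- symmetry and positivity
  have hAsymm : ∀ k l q, Ac k l q = Ac l k q := by
    intro k l q
    simp only [hAc]
    congr 1
    have hsym : (chartGramMatrix ((h q.2).toContMDiffRiemannianMetric (hR q.2)) x₀ q.1).IsSymm :=
      Matrix.IsSymm.ext fun i j ↦ chartGramMatrix_apply_comm _ x₀ q.1 j i
    exact (hsym.inv.apply k l).symm
  have hApos : ∀ q ∈ φ.target ×ˢ T, ∀ v : Fin m → ℝ, v ≠ 0 →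
      0 < ∑ k, ∑ l, Ac k l q * (v k * v l) :=
    fun q hq v hv ↦ heatCoeff_chart_pos (hR q.2) x₀ hq.1 v hv
  have hJpos : ∀ q ∈ φ.target ×ˢ T, 0 < Jc q := fun q hq ↦ sqrt_det_chartGramMatrix_pos _ x₀ hq.1
  -- local integrability of the representative and the chart identity
  have hū : LocallyIntegrableOn (fun q : 𝔼 ↦ u (φ.symm q.1, q.2)) (φ.target ×ˢ T)
      (volume : Measure 𝔼) := by
    have hu' : LocallyIntegrableOn u (univ ×ˢ T)
        ((riemannianMeasure (g₀.toContMDiffRiemannianMetric hR₀)).prod (volume : Measure ℝ)) := by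
      rw [← riemVolume_eq hR₀]; exact hu
    exact locallyIntegrableOn_comp_chart_prod (g₀.toContMDiffRiemannianMetric hR₀) x₀ hT hum hu'
  have hchart : ∀ ψ : 𝔼 → ℝ, ContDiff ℝ ∞ ψ → HasCompactSupport ψ → tsupport ψ ⊆ φ.target ×ˢ T →
      ∫ q, u (φ.symm q.1, q.2) * heatTranspose Ac Jc qc ψ q = ∫ q, Fc q * ψ q :=
    fun ψ hψ hψc hψT ↦ integral_heatTranspose_chart_of_veryWeak hh hR hR₀ hQ hG hT hum hu hweak x₀
      Jc qc Fc Ac (fun _ ↦ rfl) (fun _ _ _ ↦ rfl) (fun _ ↦ rfl) (fun _ ↦ rfl) hψ hψc hψT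
  -- Hörmander in the chart
  have hp₀Ω : ((φ x₀, s₀) : 𝔼) ∈ φ.target ×ˢ T := ⟨φ.map_source (mem_extChartAt_source x₀), hs₀⟩
  obtain ⟨U, hUo, hpU, hUΩ, w, hw, hae⟩ := exists_contDiffOn_ae_eq_of_heat_veryWeak hΩ
    (fun k l ↦ (hAcs k l).mono hΩO) hAsymm hApos (hJcs.mono hΩO) hJpos (hqcs.mono hΩO)
    (hFcs.mono hΩO) hū hchart hp₀Ω
  -- pull back
  set V : Set (M × ℝ) := {p | p.1 ∈ φ.source ∧ ((φ p.1, p.2) : 𝔼) ∈ U} with hVdef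
  have hΦc : ContinuousOn (fun p : M × ℝ ↦ ((φ p.1, p.2) : 𝔼)) (φ.source ×ˢ (univ : Set ℝ)) :=
    ((continuousOn_extChartAt x₀).comp continuous_fst.continuousOn
      (fun p hp ↦ hp.1)).prodMk continuous_snd.continuousOn
  have hVo : IsOpen V := by
    have h1 := hΦc.isOpen_inter_preimage ((isOpen_extChartAt_source x₀).prod isOpen_univ) hUo
    have : V = φ.source ×ˢ (univ : Set ℝ) ∩ (fun p : M × ℝ ↦ ((φ p.1, p.2) : 𝔼)) ⁻¹' U := by
      ext p; simp [hVdef]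
    rw [this]; exact h1
  have hpV : ((x₀, s₀) : M × ℝ) ∈ V := ⟨mem_extChartAt_source x₀, hpU⟩
  have hVT : V ⊆ univ ×ˢ T := fun p hp ↦ ⟨mem_univ _, (hUΩ hp.2).2⟩
  refine ⟨V, hVo, hpV, hVT, fun p ↦ w (φ p.1, p.2), ?_, ?_⟩
  · have hwU : ContMDiffOn 𝓘(ℝ, 𝔼) 𝓘(ℝ, ℝ) ∞ w U := contMDiffOn_iff_contDiffOn.2 hw
    have hΦ : ContMDiffOn (I.prod 𝓘(ℝ, ℝ)) 𝓘(ℝ, 𝔼) ∞ (fun p : M × ℝ ↦ ((φ p.1, p.2) : 𝔼)) V :=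
      (contMDiffOn_extChartAt_prod_id x₀ univ).mono fun p hp ↦ ⟨hp.1, mem_univ _⟩
    exact hwU.comp hΦ fun p hp ↦ hp.2
  · have h1 : ∀ᵐ p ∂(riemannianMeasure (g₀.toContMDiffRiemannianMetric hR₀)).prod (volume : Measure ℝ),
        p.1 ∈ φ.source → ((φ p.1, p.2) : 𝔼) ∈ U → u (φ.symm (φ p.1), p.2) = w (φ p.1, p.2) :=
      ae_prod_chart_of_ae_volume (g₀.toContMDiffRiemannianMetric hR₀) x₀
        (P := fun q : 𝔼 ↦ q ∈ U → u (φ.symm q.1, q.2) = w q) hae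
    rw [← riemVolume_eq hR₀] at h1
    filter_upwards [h1] with p hp hpV
    have h2 := hp hpV.1 hpV.2
    rwa [φ.left_inv hpV.1] at h2

end Regularity

end Literature.Geometry.Riemannian
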